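import Mathlib.Analysis.SpecialFunctions.ImproperIntegrals
import Mathlib.Analysis.SpecialFunctions.Trigonometric.ArctanDeriv
import Mathlib.Analysis.Complex.Exponential
import Summits.RiemannHypothesis.RiemannHypothesis.Theorems.UniversalFactorLaplaceLoopholeConvolution

/-!
# RiemannHypothesis / UniversalFactor — `NarrowKernelNoGo`, stub K1b (energy upper bound), part 1:
the Lorentz kernels and the log-free harmonic sum

Route `RiemannHypothesis/UniversalFactor`, crux `NarrowKernelNoGo` (stmt-RiemannHypothesis-2576), line
`Sketch`, stub `stub_narrowEnergyUpper`: the log-free upper bound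
`∫_T^{2T+1} (I₁ w + I₀ w')² ≤ C T` for the derivative of the Lorentz-filtered Hardy function.
This first file is pure real/complex analysis:

* `UniversalFactor.narrowUpper_integrable_pow_mul_exp` — `(2+|u|)^m e^{-c|u|}` is integrable, and the
  domination principle `UniversalFactor.narrowUpper_integrable_of_le` used for every `u`-integral of
  the stub;
* `UniversalFactor.narrowUpper_transform_k0`, `UniversalFactor.narrowUpper_transform_k1` — the explicit
  transforms `∫ℝ k(u) e^{-πu/4} e^{iωu} du` of the two kernels `k₀(u) = e^{-2a|u|}`,
  `k₁(u) = 2a·sgn(u) e^{-2a|u|}`: `1/(2a+π/4−iω) ± 1/(2a−π/4+iω)` (times `2a` for `k₁`), and the bounds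
  `‖1/(α+iβ)‖² ≤ (1+1/c²)/(1+β²)`, `‖1/(α+iβ) − 1/(α+iβ')‖ ≤ |β − β'|/α²` behind
  `|ĝ(ω)|² ≤ G₀/(1+ω²)` and `|ĝ(ω) − ĝ(ω')| ≤ G₁|ω − ω'|`;
* `UniversalFactor.narrowUpper_sum_logfree` (registered sub-stub; `…_of` is the working form) — **the estimate that kills the logarithm**:
  `∑_{n ≤ P} 1/(n (1 + (L − log n)²)) ≤ 1 + 3π` for every real `L` and every `P`
  (comparison with `d/dx arctan(log x − L)`).

References: Titchmarsh, *The Theory of the Riemann Zeta-Function* (1986), §7.2–7.4 (mean values of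
Dirichlet polynomials); the Fourier pair `e^{-α u} 𝟙_{u>0} ↔ 1/(α − iω)` is standard.
-/

noncomputable section

-- D-0017: `Summit.<S>.<S>.…` is the designed namespace of a single-problem summit.
set_option linter.dupNamespace false

namespace Summit.RiemannHypothesis.RiemannHypothesis.Theorems

open MeasureTheory Set Filter Complex intervalIntegral
open scoped Real Topology
open Literature.NumberTheory.LFunctions

/-! ## Weighted integrability on `ℝ` -/

/-- `(2+|u|)^m e^{-c|u|} ≤ (m! (2/c)^m e^{c}) · e^{-c|u|/2}` (`c > 0`): polynomial growth is absorbed by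
half of the exponential decay (`x^m ≤ m! e^x`). [folklore] -/
theorem UniversalFactor.narrowUpper_pow_mul_exp_le {c : ℝ} (hc : 0 < c) (m : ℕ) (u : ℝ) :
    (2 + |u|) ^ m * Real.exp (-(c * |u|)) ≤
      (m.factorial * (2 / c) ^ m * Real.exp c) * Real.exp (-(c / 2 * |u|)) := by
  set x := c / 2 * (2 + |u|) with hx
  have hx0 : 0 ≤ x := by positivity
  have h1 : x ^ m ≤ m.factorial * Real.exp x := by
    have h := Real.pow_div_factorial_le_exp x hx0 m
    rw [div_le_iff₀ (by positivity)] at h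
    linarith
  have h2 : (2 + |u|) ^ m = (2 / c) ^ m * x ^ m := by
    rw [← mul_pow]; congr 1; rw [hx]; field_simp
  have h3 : Real.exp x * Real.exp (-(c * |u|)) = Real.exp c * Real.exp (-(c / 2 * |u|)) := by
    rw [← Real.exp_add, ← Real.exp_add]; congr 1; rw [hx]; ring
  calc (2 + |u|) ^ m * Real.exp (-(c * |u|))
      = (2 / c) ^ m * x ^ m * Real.exp (-(c * |u|)) := by rw [h2]
    _ ≤ (2 / c) ^ m * (m.factorial * Real.exp x) * Real.exp (-(c * |u|)) := by gcongr
    _ = m.factorial * (2 / c) ^ m * (Real.exp x * Real.exp (-(c * |u|))) := by ring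
    _ = (m.factorial * (2 / c) ^ m * Real.exp c) * Real.exp (-(c / 2 * |u|)) := by rw [h3]; ring

/-- `u ↦ (2+|u|)^m e^{-c|u|}` is integrable over `ℝ` (`c > 0`). [folklore] -/
theorem UniversalFactor.narrowUpper_integrable_pow_mul_exp {c : ℝ} (hc : 0 < c) (m : ℕ) :
    Integrable fun u : ℝ => (2 + |u|) ^ m * Real.exp (-(c * |u|)) := by
  have hint : Integrable fun u : ℝ =>
      (m.factorial * (2 / c) ^ m * Real.exp c) * Real.exp (-(c / 2 * |u|)) :=
    (integrable_exp_neg_mul_abs (by positivity : 0 < c / 2)).const_mul _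
  refine hint.mono' (Continuous.aestronglyMeasurable (by fun_prop)) (Eventually.of_forall fun u => ?_)
  rw [Real.norm_eq_abs, abs_of_nonneg (by positivity)]
  exact UniversalFactor.narrowUpper_pow_mul_exp_le hc m u

/-- Domination principle: an a.e.-measurable `f` with `‖f u‖ ≤ A (2+|u|)^m e^{-c|u|}` (`c > 0`) is
integrable over `ℝ`. [folklore] -/
theorem UniversalFactor.narrowUpper_integrable_of_le {F : Type*} [NormedAddCommGroup F] {f : ℝ → F}
    (hf : AEStronglyMeasurable f volume) {c : ℝ} (hc : 0 < c) (A : ℝ) (m : ℕ)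
    (hle : ∀ u, ‖f u‖ ≤ A * ((2 + |u|) ^ m * Real.exp (-(c * |u|)))) : Integrable f :=
  ((UniversalFactor.narrowUpper_integrable_pow_mul_exp hc m).const_mul A).mono' hf
    (Eventually.of_forall hle)

/-- `∫ℝ A (2+|u|)^m e^{-c|u|} du = A · ∫ℝ (2+|u|)^m e^{-c|u|} du` is a finite nonnegative multiple of `A`:
the moment `∫ℝ (2+|u|)^m e^{-c|u|} du` is `≥ 0`. [folklore] -/
theorem UniversalFactor.narrowUpper_moment_nonneg (c : ℝ) (m : ℕ) :
    0 ≤ ∫ u : ℝ, (2 + |u|) ^ m * Real.exp (-(c * |u|)) :=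
  integral_nonneg fun u => by positivity

/-! ## The profile `e^{-2a|u|} e^{-πu/4}` -/

/-- The exponent of the tilted profile: `−2a|u| − πu/4 ≤ −(2a − π/4)|u|`, i.e.
`e^{-2a|u|} e^{-πu/4} ≤ e^{-(2a−π/4)|u|}`. [folklore] -/
theorem UniversalFactor.narrowUpper_exponent_le (a u : ℝ) :
    -(2 * a * |u|) + -(π * u / 4) ≤ -((2 * a - π / 4) * |u|) := by
  have h : -u ≤ |u| := neg_le_abs u
  nlinarith [Real.pi_pos]

/-! ## Half-line Laplace transforms -/

/-- `∫_{u>0} e^{-αu} e^{iωu} du = 1/(α − iω)` for `α > 0`. [folklore] -/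
theorem UniversalFactor.narrowUpper_integral_Ioi_exp {α : ℝ} (hα : 0 < α) (ω : ℝ) :
    ∫ u in Ioi (0:ℝ), ((Real.exp (-(α * u)) : ℝ) : ℂ) * cexp (↑(ω * u) * I) =
      1 / ((α : ℂ) - ω * I) := by
  have hre : (-(α : ℂ) + ω * I).re < 0 := by simp [hα]
  have heq : ∀ u : ℝ, ((Real.exp (-(α * u)) : ℝ) : ℂ) * cexp (↑(ω * u) * I) =
      cexp ((-(α : ℂ) + ω * I) * u) := by
    intro u; rw [Complex.ofReal_exp, ← Complex.exp_add]; congr 1; push_cast; ring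
  simp_rw [heq]
  rw [integral_exp_mul_complex_Ioi hre 0, Complex.ofReal_zero, mul_zero, Complex.exp_zero, neg_div,
    ← div_neg]
  congr 1; ring

/-- `∫_{u≤0} e^{αu} e^{iωu} du = 1/(α + iω)` for `α > 0`. [folklore] -/
theorem UniversalFactor.narrowUpper_integral_Iic_exp {α : ℝ} (hα : 0 < α) (ω : ℝ) :
    ∫ u in Iic (0:ℝ), ((Real.exp (α * u) : ℝ) : ℂ) * cexp (↑(ω * u) * I) = 1 / ((α : ℂ) + ω * I) := by
  have hre : 0 < ((α : ℂ) + ω * I).re := by simp [hα]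
  have heq : ∀ u : ℝ, ((Real.exp (α * u) : ℝ) : ℂ) * cexp (↑(ω * u) * I) =
      cexp (((α : ℂ) + ω * I) * u) := by
    intro u; rw [Complex.ofReal_exp, ← Complex.exp_add]; congr 1; push_cast; ring
  simp_rw [heq]
  rw [integral_exp_mul_complex_Iic hre 0, Complex.ofReal_zero, mul_zero, Complex.exp_zero]

/-! ## The transforms of the two Lorentz kernels against `e^{-πu/4}` -/

/-- **Transform of `k₀ e^{-πu/4}`**: for `a > π/8` and real `ω`,
`∫ℝ e^{-2a|u|} e^{-πu/4} e^{iωu} du = 1/(2a + π/4 − iω) + 1/(2a − π/4 + iω)`. [folklore] -/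
theorem UniversalFactor.narrowUpper_transform_k0 {a : ℝ} (ha : π / 8 < a) (ω : ℝ) :
    ∫ u : ℝ, ((Real.exp (-(2 * a * |u|)) * Real.exp (-(π * u / 4)) : ℝ) : ℂ) * cexp (↑(ω * u) * I) =
      1 / (((2 * a + π / 4 : ℝ) : ℂ) - ω * I) + 1 / (((2 * a - π / 4 : ℝ) : ℂ) + ω * I) := by
  set f : ℝ → ℂ := fun u =>
    ((Real.exp (-(2 * a * |u|)) * Real.exp (-(π * u / 4)) : ℝ) : ℂ) * cexp (↑(ω * u) * I) with hf
  have hc : 0 < 2 * a - π / 4 := by linarith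
  have hp : 0 < 2 * a + π / 4 := by linarith [Real.pi_pos]
  have hint : Integrable f := by
    refine UniversalFactor.narrowUpper_integrable_of_le (Continuous.aestronglyMeasurable (by fun_prop))
      hc 1 0 fun u => ?_
    simp only [hf, norm_mul, Complex.norm_real, Complex.norm_exp_ofReal_mul_I, mul_one, pow_zero, one_mul,
      Real.norm_eq_abs, Real.abs_exp]
    rw [← Real.exp_add]
    exact Real.exp_le_exp.2 (UniversalFactor.narrowUpper_exponent_le a u)
  rw [← integral_Iic_add_Ioi (b := 0) hint.integrableOn hint.integrableOn, add_comm]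
  congr 1
  · rw [← UniversalFactor.narrowUpper_integral_Ioi_exp hp ω]
    refine setIntegral_congr_fun measurableSet_Ioi fun u (hu : 0 < u) => ?_
    simp only [hf]
    rw [abs_of_pos hu, ← Real.exp_add]
    congr 3; ring
  · rw [← UniversalFactor.narrowUpper_integral_Iic_exp hc ω]
    refine setIntegral_congr_fun measurableSet_Iic fun u (hu : u ≤ 0) => ?_
    simp only [hf]
    rw [abs_of_nonpos hu, ← Real.exp_add]
    congr 3; ring

/-- **Transform of `k₁ e^{-πu/4}`**: for `a > π/8` and real `ω`,
`∫ℝ 2a sgn(u) e^{-2a|u|} e^{-πu/4} e^{iωu} du = 2a (1/(2a + π/4 − iω) − 1/(2a − π/4 + iω))`. [folklore] -/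
theorem UniversalFactor.narrowUpper_transform_k1 {a : ℝ} (ha : π / 8 < a) (ω : ℝ) :
    ∫ u : ℝ, ((2 * a * Real.sign u * Real.exp (-(2 * a * |u|)) * Real.exp (-(π * u / 4)) : ℝ) : ℂ) *
        cexp (↑(ω * u) * I) =
      2 * a * (1 / (((2 * a + π / 4 : ℝ) : ℂ) - ω * I) - 1 / (((2 * a - π / 4 : ℝ) : ℂ) + ω * I)) := by
  set f : ℝ → ℂ := fun u =>
    ((2 * a * Real.sign u * Real.exp (-(2 * a * |u|)) * Real.exp (-(π * u / 4)) : ℝ) : ℂ) *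
      cexp (↑(ω * u) * I) with hf
  have hc : 0 < 2 * a - π / 4 := by linarith
  have ha0 : 0 < a := by linarith [Real.pi_pos]
  have hp : 0 < 2 * a + π / 4 := by linarith [Real.pi_pos]
  have hmeas : AEStronglyMeasurable f volume := by
    refine Measurable.aestronglyMeasurable ?_
    have hs : Measurable Real.sign := by
      have h : Real.sign = fun r : ℝ => if r < 0 then (-1 : ℝ) else if 0 < r then 1 else 0 := by
        funext r; rfl
      rw [h]
      exact Measurable.ite measurableSet_Iio measurable_const
        (Measurable.ite measurableSet_Ioi measurable_const measurable_const)
    simp only [hf]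
    fun_prop
  have hint : Integrable f := by
    refine UniversalFactor.narrowUpper_integrable_of_le hmeas hc (2 * a) 0 fun u => ?_
    simp only [hf, norm_mul, Complex.norm_real, Complex.norm_exp_ofReal_mul_I, mul_one, pow_zero, one_mul,
      Real.norm_eq_abs, Real.abs_exp]
    rw [abs_of_pos (by norm_num : (0:ℝ) < 2), abs_of_pos ha0]
    have h1 : Real.exp (-(2 * a * |u|)) * Real.exp (-(π * u / 4)) ≤ Real.exp (-((2 * a - π / 4) * |u|)) := by
      rw [← Real.exp_add]; exact Real.exp_le_exp.2 (UniversalFactor.narrowUpper_exponent_le a u)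
    have h2 : |Real.sign u| ≤ 1 := by
      rcases Real.sign_apply_eq u with h | h | h <;> rw [h] <;> norm_num
    calc 2 * a * |Real.sign u| * Real.exp (-(2 * a * |u|)) * Real.exp (-(π * u / 4))
        = (2 * a * |Real.sign u|) * (Real.exp (-(2 * a * |u|)) * Real.exp (-(π * u / 4))) := by ring
      _ ≤ (2 * a * 1) * Real.exp (-((2 * a - π / 4) * |u|)) := by gcongr
      _ = 2 * a * Real.exp (-((2 * a - π / 4) * |u|)) := by ring
  rw [← integral_Iic_add_Ioi (b := 0) hint.integrableOn hint.integrableOn, add_comm, mul_sub, sub_eq_add_neg]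
  congr 1
  · rw [← UniversalFactor.narrowUpper_integral_Ioi_exp hp ω, ← MeasureTheory.integral_const_mul]
    refine setIntegral_congr_fun measurableSet_Ioi fun u (hu : 0 < u) => ?_
    have hreal : 2 * a * Real.sign u * Real.exp (-(2 * a * |u|)) * Real.exp (-(π * u / 4)) =
        2 * a * Real.exp (-((2 * a + π / 4) * u)) := by
      rw [abs_of_pos hu, Real.sign_of_pos hu, show -((2 * a + π / 4) * u) = -(2 * a * u) + -(π * u / 4) by ring,
        Real.exp_add]; ring
    simp only [hf]
    rw [hreal]; push_cast; ring
  · rw [← UniversalFactor.narrowUpper_integral_Iic_exp hc ω, ← neg_mul, ← MeasureTheory.integral_const_mul,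
      integral_Iic_eq_integral_Iio, integral_Iic_eq_integral_Iio]
    refine setIntegral_congr_fun measurableSet_Iio fun u (hu : u < 0) => ?_
    have hreal : 2 * a * Real.sign u * Real.exp (-(2 * a * |u|)) * Real.exp (-(π * u / 4)) =
        -(2 * a) * Real.exp ((2 * a - π / 4) * u) := by
      rw [abs_of_neg hu, Real.sign_of_neg hu, show (2 * a - π / 4) * u = -(2 * a * -u) + -(π * u / 4) by ring,
        Real.exp_add]; ring
    simp only [hf]
    rw [hreal]; push_cast; ring

/-! ## Bounds for the fractions `1/(α + iβ)` -/

/-- `‖1/(α + iβ)‖² = 1/(α² + β²)`. [folklore] -/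
theorem UniversalFactor.narrowUpper_norm_sq_inv (α β : ℝ) :
    ‖(1 : ℂ) / ((α : ℂ) + β * I)‖ ^ 2 = 1 / (α ^ 2 + β ^ 2) := by
  rw [norm_div, norm_one, div_pow, one_pow, Complex.sq_norm, Complex.normSq_apply]
  simp; ring

/-- `‖1/(α + iβ)‖² ≤ (1 + 1/c²)/(1 + β²)` when `α² ≥ c² > 0`. [folklore] -/
theorem UniversalFactor.narrowUpper_norm_sq_inv_le {α β c : ℝ} (hc : 0 < c) (hα : c ^ 2 ≤ α ^ 2) :
    ‖(1 : ℂ) / ((α : ℂ) + β * I)‖ ^ 2 ≤ (1 + 1 / c ^ 2) / (1 + β ^ 2) := by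
  rw [UniversalFactor.narrowUpper_norm_sq_inv]
  have hc2 : 0 < c ^ 2 := by positivity
  have hα2 : 0 < α ^ 2 + β ^ 2 := by nlinarith [sq_nonneg β]
  rw [div_le_div_iff₀ hα2 (by positivity)]
  have h2 : 1 ≤ α ^ 2 / c ^ 2 := by rw [le_div_iff₀ hc2]; linarith
  have h3 : α ^ 2 / c ^ 2 ≤ (α ^ 2 + β ^ 2) / c ^ 2 :=
    div_le_div_of_nonneg_right (by nlinarith [sq_nonneg β]) hc2.le
  have h4 : (1 + 1 / c ^ 2) * (α ^ 2 + β ^ 2) = α ^ 2 + β ^ 2 + (α ^ 2 + β ^ 2) / c ^ 2 := by ring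
  rw [h4]
  nlinarith [sq_nonneg α, sq_nonneg β]

/-- Lipschitz bound `‖1/(α + iβ) − 1/(α + iβ')‖ ≤ |β − β'|/α²` for `α ≠ 0`. [folklore] -/
theorem UniversalFactor.narrowUpper_inv_sub_inv_le {α : ℝ} (hα : α ≠ 0) (β β' : ℝ) :
    ‖(1 : ℂ) / ((α : ℂ) + β * I) - 1 / ((α : ℂ) + β' * I)‖ ≤ |β - β'| / α ^ 2 := by
  have hne : ∀ b : ℝ, (α : ℂ) + b * I ≠ 0 := fun b h => by
    have := congrArg Complex.re h; simp at this; exact hα this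
  have hge : ∀ b : ℝ, |α| ≤ ‖(α : ℂ) + b * I‖ := fun b => by
    have := abs_re_le_norm ((α : ℂ) + b * I); simpa using this
  rw [div_sub_div _ _ (hne β) (hne β'), norm_div, norm_mul]
  have hnum : ‖1 * ((α : ℂ) + β' * I) - ((α : ℂ) + β * I) * 1‖ = |β - β'| := by
    rw [show (1 : ℂ) * ((α : ℂ) + β' * I) - ((α : ℂ) + β * I) * 1 = ((β' - β : ℝ) : ℂ) * I by push_cast; ring,
      Complex.norm_mul, Complex.norm_real, Complex.norm_I, mul_one, Real.norm_eq_abs, abs_sub_comm]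
  rw [hnum]
  have hα2 : 0 < α ^ 2 := by positivity
  have hprod : α ^ 2 ≤ ‖(α : ℂ) + β * I‖ * ‖(α : ℂ) + β' * I‖ := by
    rw [← sq_abs, sq]
    exact mul_le_mul (hge β) (hge β') (abs_nonneg _) (norm_nonneg _)
  exact div_le_div_of_nonneg_left (abs_nonneg _) hα2 hprod

/-! ## The log-free harmonic sum -/

/-- One step of the comparison: for `n ≥ 1`,
`1/((n+1)(1 + (L − log(n+1))²)) ≤ 3 (arctan(log(n+1) − L) − arctan(log n − L))` (mean value theorem for
`x ↦ arctan(log x − L)`, whose derivative `1/(x(1 + (log x − L)²))` changes by at most a factor `3` on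
`[n, n+1]`). [folklore] -/
theorem UniversalFactor.narrowUpper_logfree_step (L : ℝ) {n : ℕ} (hn : 1 ≤ n) :
    1 / (((n : ℝ) + 1) * (1 + (L - Real.log ((n : ℝ) + 1)) ^ 2)) ≤
      3 * (Real.arctan (Real.log ((n : ℝ) + 1) - L) - Real.arctan (Real.log n - L)) := by
  have hn0 : (0 : ℝ) < n := by exact_mod_cast hn
  set F : ℝ → ℝ := fun x => Real.arctan (Real.log x - L) with hF
  set F' : ℝ → ℝ := fun x => 1 / (1 + (Real.log x - L) ^ 2) * x⁻¹ with hF'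
  have hder : ∀ x, 0 < x → HasDerivAt F (F' x) x := fun x hx =>
    ((Real.hasDerivAt_log hx.ne').sub_const L).arctan
  have hcont : ContinuousOn F (Icc (n : ℝ) (n + 1)) := fun x hx =>
    (hder x (hn0.trans_le hx.1)).continuousAt.continuousWithinAt
  obtain ⟨ξ, hξ, hslope⟩ := exists_hasDerivAt_eq_slope F F' (by linarith : (n : ℝ) < n + 1) hcont
    (fun x hx => hder x (hn0.trans hx.1))
  rw [show (n : ℝ) + 1 - n = 1 by ring, div_one] at hslope
  have hξ0 : 0 < ξ := hn0.trans hξ.1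
  have hn1 : (1 : ℝ) ≤ n := by exact_mod_cast hn
  -- `F'(ξ) ≥ f(n+1)/3`
  set A := Real.log ((n : ℝ) + 1) - L with hA
  set B := Real.log ξ - L with hB
  have hlogle : Real.log ξ ≤ Real.log ((n : ℝ) + 1) := Real.log_le_log hξ0 hξ.2.le
  have hloglb : Real.log ((n : ℝ) + 1) - Real.log ξ ≤ 1 := by
    rw [← Real.log_div (by positivity) hξ0.ne']
    have h1 := Real.log_le_sub_one_of_pos (show 0 < ((n : ℝ) + 1) / ξ by positivity)
    have h2 : ((n : ℝ) + 1) / ξ - 1 ≤ 1 := by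
      rw [div_sub_one hξ0.ne', div_le_one hξ0]; linarith [hξ.1]
    linarith
  have hsq : B ^ 2 ≤ 2 * A ^ 2 + 2 := by
    have : B = A - (Real.log ((n : ℝ) + 1) - Real.log ξ) := by rw [hA, hB]; ring
    rw [this]
    nlinarith [sq_nonneg (A + (Real.log ((n : ℝ) + 1) - Real.log ξ)), hloglb, hlogle]
  have hAsq : (L - Real.log ((n : ℝ) + 1)) ^ 2 = A ^ 2 := by rw [hA]; ring
  have hpos2 : 0 < (1 + B ^ 2) * ξ := by positivity
  have hkey : (1 + B ^ 2) * ξ ≤ 3 * (((n : ℝ) + 1) * (1 + A ^ 2)) := by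
    have h1 : 1 + B ^ 2 ≤ 3 * (1 + A ^ 2) := by nlinarith [sq_nonneg A]
    have h2 : ξ ≤ (n : ℝ) + 1 := hξ.2.le
    calc (1 + B ^ 2) * ξ ≤ (3 * (1 + A ^ 2)) * ((n : ℝ) + 1) := mul_le_mul h1 h2 hξ0.le (by positivity)
      _ = 3 * (((n : ℝ) + 1) * (1 + A ^ 2)) := by ring
  have hF'ξ : F' ξ = 1 / (1 + B ^ 2) * ξ⁻¹ := rfl
  rw [hAsq, ← hslope, hF'ξ]
  have hpos1 : 0 < ((n : ℝ) + 1) * (1 + A ^ 2) := by positivity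
  calc 1 / (((n : ℝ) + 1) * (1 + A ^ 2)) = 3 / (3 * (((n : ℝ) + 1) * (1 + A ^ 2))) := by
        conv_rhs => rw [← div_div, div_self (by norm_num : (3:ℝ) ≠ 0)]
    _ ≤ 3 / ((1 + B ^ 2) * ξ) := div_le_div_of_nonneg_left (by norm_num) hpos2 hkey
    _ = 3 * (1 / (1 + B ^ 2) * ξ⁻¹) := by rw [div_eq_mul_inv, mul_inv, one_div]

/-- **The log-free harmonic sum.** For every real `L` and every `P`,
`∑_{n=1}^{P} 1/(n (1 + (L − log n)²)) ≤ 1 + 3π`. With `L = log N` the weights `1/(1 + log²(N/n))` are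
those of a filter `|k̂(log(N/n))|² ≍ min(1, 1/log²(N/n))`; the plain harmonic sum `∑ 1/n ∼ log P` loses
a logarithm, this one does not. [folklore] -/
theorem UniversalFactor.narrowUpper_sum_logfree_of (L : ℝ) (P : ℕ) :
    ∑ n ∈ Finset.Icc 1 P, 1 / ((n : ℝ) * (1 + (L - Real.log n) ^ 2)) ≤ 1 + 3 * π := by
  set F : ℕ → ℝ := fun n => Real.arctan (Real.log n - L) with hF
  rcases Nat.eq_zero_or_pos P with rfl | hP
  · simp; positivity
  have key : ∀ Q : ℕ, 1 ≤ Q →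
      ∑ n ∈ Finset.Icc 1 Q, 1 / ((n : ℝ) * (1 + (L - Real.log n) ^ 2)) ≤ 1 + 3 * (F Q - F 1) := by
    intro Q hQ
    induction Q, hQ using Nat.le_induction with
    | base =>
      simp only [Finset.Icc_self, Finset.sum_singleton, Nat.cast_one, one_mul, sub_self, mul_zero, add_zero]
      rw [div_le_one (by positivity)]
      nlinarith [sq_nonneg (L - Real.log 1)]
    | succ Q hQ ih =>
      rw [Finset.sum_Icc_succ_top (by omega), Nat.cast_succ]
      have hstep := UniversalFactor.narrowUpper_logfree_step L hQ
      have : F (Q + 1) = Real.arctan (Real.log ((Q : ℝ) + 1) - L) := by simp [hF]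
      rw [this]
      have hFQ : F Q = Real.arctan (Real.log Q - L) := rfl
      rw [hFQ] at ih
      linarith
  refine (key P hP).trans ?_
  have h1 : F P < π / 2 := Real.arctan_lt_pi_div_two _
  have h2 : -(π / 2) < F 1 := Real.neg_pi_div_two_lt_arctan _
  linarith

/-- **Registered sub-stub `narrowUpper_sum_logfree`** (verbatim signature): the log-free harmonic sum. [folklore] -/
theorem UniversalFactor.narrowUpper_sum_logfree : ∀ (L : ℝ) (P : ℕ), ∑ n ∈ Finset.Icc 1 P, 1 / ((n : ℝ) * (1 + (L - Real.log n) ^ 2)) ≤ 1 + 3 * Real.pi :=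
  fun L P => UniversalFactor.narrowUpper_sum_logfree_of L P

end Summit.RiemannHypothesis.RiemannHypothesis.Theorems
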